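import Mathlib
import HarnessLib
import Literature.MathematicalPhysics.StatisticalMechanics.RelevantProjection

/-!
# Boundedness of `Π₂` ([ABKM19] Lemma 8.7): `‖Π₂K(B)‖_{k,0} ≤ C |K(B)|_{k,B,T_0}`

With the coefficient norm `hamNorm 𝔥 R |B|` of `RelevantHamiltonianNorm` ((6.51)) and the Taylor norm
`tayNorm T r₀ K 0` at the zero field for the gauge `T = fieldGauge 𝔥 R p S` ((6.46)), the projection
`Π₂` of `RelevantProjection` is bounded with a constant depending only on `d` and on the ratio
`C₀ ≥ (ρ + ⌊d/2⌋+1)/R` of the box containing the gauge set `S ⊇ B` to the length unit `R` of the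
gauge: **`hamNorm_Pi2_le`**.  The three parts: the constant coefficient (`|B| |a_∅| = |K(0)| ≤ |K|_{T_0}`),
the quadratic coefficients (duality `|D²K(0)(b_i,b_j)| ≤ 2|K|_{T_0}‖Tb_i‖‖Tb_j‖` and
`‖Tb_i‖ ≤ R/𝔥`), and the linear coefficients (the Neumann inverse of the graded-nilpotent system with
the weighted entry bounds `|N_{α'α}| ≤ (C₀R)^{|α'|−|α|}` of
`RigorousRGSmallParameterGradedNilpotentInverse.abs_neumann_apply_le`).

* `norm_fderiv_apply_le_tayNorm`, `norm_iteratedFDeriv_two_apply_le_tayNorm` (duality, `s = 1, 2`);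
* `abs_linSysNil_le`, `abs_linSysInv_le` (weighted entry bounds, weights `(C₀R)^{|α|}`);
* `pi2GeoSum d`, `pi2BoundConst d C₀` and **`hamNorm_Pi2_le`**.

Everything is proved; no named fact.

## References
* S. Adams, S. Buchholz, R. Kotecký, S. Müller, arXiv:1910.13564, Lemma 8.7 and its proof
  ((8.49)–(8.53)) [AdamsBuchholzKoteckyMuller2019].
* D. Brydges, G. Slade, J. Stat. Phys. 159 (2015) 461–491, §2.2 (e:Ainvbd) [BrydgesSlade2015RGII].
-/

noncomputable section

namespace Literature.MathematicalPhysics.StatisticalMechanics.GradientRG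

open Finset Matrix
open Literature.Barriers.CriticalPhenomena.LongRangePhi4 (GradedNilpotent.neumann
  GradedNilpotent.abs_neumann_apply_le)

variable {𝕜 : Type*} [NormedField 𝕜] [NormedAlgebra ℝ 𝕜] {d M : ℕ} [NeZero M]

/-! ## Duality bounds for the first two derivatives -/

/-- `‖DK(φ)(ξ)‖ ≤ |K|_{T_φ} ‖Tξ‖` (`r₀ ≥ 1`, `K` gauge-local).
[cite: AdamsBuchholzKoteckyMuller2019, Ch. 6.4 (6.45)–(6.46)] -/
theorem norm_fderiv_apply_le_tayNorm {V : Type*} [NormedAddCommGroup V] [NormedSpace ℝ V]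
    {T : ((Fin d → ZMod M) → ℝ) →ₗ[ℝ] V} {r₀ : ℕ} (hr₀ : 1 ≤ r₀) {K : ((Fin d → ZMod M) → ℝ) → 𝕜}
    (hK : ContDiff ℝ r₀ K) (hloc : IsGaugeLocal T K) (φ ξ : (Fin d → ZMod M) → ℝ) :
    ‖fderiv ℝ K φ ξ‖ ≤ tayNorm T r₀ K φ * ‖T ξ‖ := by
  have h := norm_iteratedFDeriv_apply_le_tayNorm hK hloc φ hr₀ (fun _ : Fin 1 => ξ)
  rw [iteratedFDeriv_one_apply] at h
  simpa using h

/-- `‖D²K(φ)(ξ,η)‖ ≤ 2|K|_{T_φ} ‖Tξ‖ ‖Tη‖` (`r₀ ≥ 2`, `K` gauge-local).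
[cite: AdamsBuchholzKoteckyMuller2019, Ch. 6.4 (6.45)–(6.46)] -/
theorem norm_iteratedFDeriv_two_apply_le_tayNorm {V : Type*} [NormedAddCommGroup V] [NormedSpace ℝ V]
    {T : ((Fin d → ZMod M) → ℝ) →ₗ[ℝ] V} {r₀ : ℕ} (hr₀ : 2 ≤ r₀) {K : ((Fin d → ZMod M) → ℝ) → 𝕜}
    (hK : ContDiff ℝ r₀ K) (hloc : IsGaugeLocal T K) (φ ξ η : (Fin d → ZMod M) → ℝ) :
    ‖iteratedFDeriv ℝ 2 K φ ![ξ, η]‖ ≤ 2 * tayNorm T r₀ K φ * ‖T ξ‖ * ‖T η‖ := by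
  have h := norm_iteratedFDeriv_apply_le_tayNorm hK hloc φ hr₀ ![ξ, η]
  rw [Fin.prod_univ_two] at h
  simpa [Nat.factorial, mul_assoc] using h

/-! ## Weighted entry bounds for the linear system -/

section LinSys

variable {c : Fin d → ZMod M} {B : Finset (Fin d → ZMod M)} {ρ : ℕ} {R C₀ : ℝ}

omit [NeZero M] in
/-- **`|N_{α'α}| ≤ (C₀R)^{|α'|}/(C₀R)^{|α|}`** when `B` lies in the box `|z|_∞ ≤ ρ` and
`ρ + ⌊d/2⌋+1 ≤ C₀R`. [cite: AdamsBuchholzKoteckyMuller2019, proof of Lemma 8.7 (8.52)] -/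
theorem abs_linSysNil_le (hB : B.card ≠ 0) (hBρ : ∀ x ∈ B, ∀ i, |relCoord c x i| ≤ ρ)
    (hR : 0 < R) (hC₀ : 1 ≤ C₀) (hρ : (ρ : ℝ) + (d / 2 + 1 : ℕ) ≤ C₀ * R) (α' α : linIndex d) :
    |linSysNil c B α' α| ≤ 1 * (C₀ * R) ^ (∑ i, (α' : Fin d → ℕ) i) / (C₀ * R) ^ (∑ i, (α : Fin d → ℕ) i) := by
  have hB' : (0 : ℝ) < B.card := by exact_mod_cast Nat.pos_of_ne_zero hB
  have hCR : 0 < C₀ * R := mul_pos (by linarith) hR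
  rw [one_mul]
  unfold linSysNil
  rw [Matrix.sub_apply, Matrix.smul_apply, smul_eq_mul]
  by_cases heq : α' = α
  · subst heq
    rw [linSysMat_diag, Matrix.one_apply_eq, inv_mul_cancel₀ hB'.ne', sub_self, abs_zero]
    positivity
  rw [Matrix.one_apply_ne heq, sub_zero]
  by_cases hle : ∀ i, (α : Fin d → ℕ) i ≤ (α' : Fin d → ℕ) i
  · unfold linSysMat
    rw [if_pos hle, abs_mul, abs_inv, abs_of_pos hB']
    set a' := ∑ i, (α' : Fin d → ℕ) i with ha'
    set a := ∑ i, (α : Fin d → ℕ) i with ha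
    have haa' : a ≤ a' := Finset.sum_le_sum fun i _ => hle i
    have hγ : ∑ i, ((α' : Fin d → ℕ) - (α : Fin d → ℕ)) i = a' - a := by
      have : ∑ i, ((α' : Fin d → ℕ) - (α : Fin d → ℕ)) i + a = a' := by
        rw [ha, ← Finset.sum_add_distrib]
        exact Finset.sum_congr rfl fun i _ => Nat.sub_add_cancel (hle i)
      omega
    have hdeg : a' ≤ d / 2 + 1 := (mem_linIndex.1 α'.2).2
    have hsum := abs_sum_polyField_le hBρ ((α' : Fin d → ℕ) - (α : Fin d → ℕ))
    rw [hγ] at hsum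
    have hbase : (ρ : ℝ) + ((a' - a : ℕ) : ℝ) ≤ C₀ * R := by
      have : ((a' - a : ℕ) : ℝ) ≤ ((d / 2 + 1 : ℕ) : ℝ) := by exact_mod_cast (Nat.sub_le a' a).trans hdeg
      linarith
    calc (B.card : ℝ)⁻¹ * |∑ x ∈ B, polyField c ((α' : Fin d → ℕ) - (α : Fin d → ℕ)) x|
        ≤ (B.card : ℝ)⁻¹ * (B.card * ((ρ : ℝ) + ((a' - a : ℕ) : ℝ)) ^ (a' - a)) := by gcongr
      _ = ((ρ : ℝ) + ((a' - a : ℕ) : ℝ)) ^ (a' - a) := by field_simp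
      _ ≤ (C₀ * R) ^ (a' - a) := pow_le_pow_left₀ (by positivity) hbase _
      _ = (C₀ * R) ^ a' / (C₀ * R) ^ a := by
          rw [eq_div_iff (by positivity), ← pow_add, Nat.sub_add_cancel haa']
  · rw [linSysMat_eq_zero hle, mul_zero, abs_zero]
    positivity

/-- The geometric sum `Σ_{k ≤ sup grade} |v_1|^k` of the Neumann bound.
[cite: AdamsBuchholzKoteckyMuller2019, proof of Lemma 8.7 (8.52)] -/
def pi2GeoSum (d : ℕ) : ℝ :=
  ∑ k ∈ range (univ.sup (linGrade (d := d)) + 1), (Fintype.card (linIndex d) * (1 : ℝ)) ^ k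

/-- `pi2GeoSum d ≥ 0`. [cite: AdamsBuchholzKoteckyMuller2019, proof of Lemma 8.7] -/
theorem pi2GeoSum_nonneg (d : ℕ) : 0 ≤ pi2GeoSum d :=
  Finset.sum_nonneg fun k _ => by positivity

omit [NeZero M] in
/-- **`|(B⁻¹)_{αα'}| ≤ |B|⁻¹ S (C₀R)^{|α|}/(C₀R)^{|α'|}`** (`S = pi2GeoSum d`).
[cite: AdamsBuchholzKoteckyMuller2019, proof of Lemma 8.7 (8.52)] -/
theorem abs_linSysInv_le (hB : B.card ≠ 0) (hBρ : ∀ x ∈ B, ∀ i, |relCoord c x i| ≤ ρ)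
    (hR : 0 < R) (hC₀ : 1 ≤ C₀) (hρ : (ρ : ℝ) + (d / 2 + 1 : ℕ) ≤ C₀ * R) (α α' : linIndex d) :
    |linSysInv c B α α'| ≤ (B.card : ℝ)⁻¹ * pi2GeoSum d *
      (C₀ * R) ^ (∑ i, (α : Fin d → ℕ) i) / (C₀ * R) ^ (∑ i, (α' : Fin d → ℕ) i) := by
  have hCR : 0 < C₀ * R := mul_pos (by linarith) hR
  unfold linSysInv
  rw [Matrix.smul_apply, smul_eq_mul, abs_mul, abs_inv, Nat.abs_cast, mul_assoc, mul_div_assoc]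
  refine mul_le_mul_of_nonneg_left ?_ (by positivity)
  have h := GradedNilpotent.abs_neumann_apply_le (N := linSysNil c B) (K₀ := 1) zero_le_one
    (w := fun β : linIndex d => (C₀ * R) ^ (∑ i, (β : Fin d → ℕ) i)) (fun β => by positivity)
    (fun i j => abs_linSysNil_le hB hBρ hR hC₀ hρ i j)
    (univ.sup (linGrade (d := d)) + 1) α α'
  unfold pi2GeoSum
  simpa only [mul_div_assoc] using h

end LinSys

/-! ## Lemma 8.7 -/

/-- The constant of Lemma 8.7: `1 + 2|v_2| + |v_1|² S C₀^{⌊d/2⌋+1}`.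
[cite: AdamsBuchholzKoteckyMuller2019, Lemma 8.7] -/
def pi2BoundConst (d : ℕ) (C₀ : ℝ) : ℝ :=
  1 + 2 * Fintype.card (quadIndex d) +
    (Fintype.card (linIndex d) : ℝ) ^ 2 * pi2GeoSum d * C₀ ^ (d / 2 + 1)

section Parts

variable {c : Fin d → ZMod M} {B S : Finset (Fin d → ZMod M)} {p ρ r₀ : ℕ} {𝔥 R C₀ : ℝ}
  {K : ((Fin d → ZMod M) → ℝ) → 𝕜}

/-- The constant coefficient: `|B| |a_∅| ≤ |K|_{T_0}`. [cite: AdamsBuchholzKoteckyMuller2019, proof of Lemma 8.7 (8.49)] -/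
theorem card_mul_norm_Pi2_const_le (hB : B.card ≠ 0) (hloc : IsGaugeLocal (fieldGauge 𝔥 R p S) K) :
    (B.card : ℝ) * ‖Pi2 c B K (Sum.inl ())‖ ≤ tayNorm (fieldGauge 𝔥 R p S) r₀ K 0 := by
  have hB' : (0 : ℝ) < B.card := by exact_mod_cast Nat.pos_of_ne_zero hB
  unfold Pi2
  rw [Pi2Data_const, norm_smul, Real.norm_eq_abs, abs_inv, Nat.abs_cast, ← mul_assoc,
    mul_inv_cancel₀ hB'.ne', one_mul]
  exact norm_apply_le_tayNorm r₀ hloc 0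

/-- A quadratic coefficient: `|B| (𝔥/R)² |a_{ij}| ≤ 2|K|_{T_0}`.
[cite: AdamsBuchholzKoteckyMuller2019, proof of Lemma 8.7 (8.50)] -/
theorem card_mul_norm_Pi2_quad_le (hB : B.card ≠ 0) (hS : ∀ x ∈ S, HasRoom c x p) (h𝔥 : 0 < 𝔥)
    (hR : 0 < R) (hr₀ : 2 ≤ r₀) (hK : ContDiff ℝ r₀ K) (hloc : IsGaugeLocal (fieldGauge 𝔥 R p S) K)
    (q : quadIndex d) :
    (B.card : ℝ) * ((𝔥 / R) ^ 2 * ‖Pi2 c B K (Sum.inr (Sum.inr q))‖) ≤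
      2 * tayNorm (fieldGauge 𝔥 R p S) r₀ K 0 := by
  set T := fieldGauge 𝔥 R p S with hT
  set t := tayNorm T r₀ K 0 with ht
  have ht0 : 0 ≤ t := tayNorm_nonneg _ _ _ _
  have hB' : (0 : ℝ) < B.card := by exact_mod_cast Nat.pos_of_ne_zero hB
  have hb1 : ∀ i : Fin d, ‖T (polyField c (Pi.single i 1))‖ ≤ R / 𝔥 := fun i =>
    norm_fieldGauge_polyField_single_le hS h𝔥 hR.le i
  unfold Pi2
  rw [Pi2Data_quad, norm_smul, Real.norm_eq_abs]
  have hN : |(B.card : ℝ)⁻¹ * (if q.1.1 = q.1.2 then (1 / 2 : ℝ) else 1)| ≤ (B.card : ℝ)⁻¹ := by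
    rw [abs_mul, abs_inv, Nat.abs_cast]
    refine mul_le_of_le_one_right (by positivity) ?_
    split_ifs
    · rw [abs_of_pos (by norm_num)]; norm_num
    · rw [abs_one]
  have hD := norm_iteratedFDeriv_two_apply_le_tayNorm hr₀ hK hloc 0
    (polyField c (Pi.single q.1.1 1)) (polyField c (Pi.single q.1.2 1))
  have hD' : ‖iteratedFDeriv ℝ 2 K 0 ![polyField c (Pi.single q.1.1 1), polyField c (Pi.single q.1.2 1)]‖ ≤
      2 * t * (R / 𝔥) * (R / 𝔥) := by
    refine hD.trans ?_
    have := hb1 q.1.1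
    have := hb1 q.1.2
    gcongr
  have hmain : |(B.card : ℝ)⁻¹ * (if q.1.1 = q.1.2 then (1 / 2 : ℝ) else 1)| *
      ‖iteratedFDeriv ℝ 2 K 0 ![polyField c (Pi.single q.1.1 1), polyField c (Pi.single q.1.2 1)]‖ ≤
      (B.card : ℝ)⁻¹ * (2 * t * (R / 𝔥) * (R / 𝔥)) :=
    mul_le_mul hN hD' (norm_nonneg _) (by positivity)
  calc (B.card : ℝ) * ((𝔥 / R) ^ 2 * (|(B.card : ℝ)⁻¹ * (if q.1.1 = q.1.2 then (1 / 2 : ℝ) else 1)| *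
        ‖iteratedFDeriv ℝ 2 K 0 ![polyField c (Pi.single q.1.1 1), polyField c (Pi.single q.1.2 1)]‖))
      ≤ (B.card : ℝ) * ((𝔥 / R) ^ 2 * ((B.card : ℝ)⁻¹ * (2 * t * (R / 𝔥) * (R / 𝔥)))) := by gcongr
    _ = 2 * t := by
        have h1 : (𝔥 / R) ^ 2 * ((R / 𝔥) * (R / 𝔥)) = 1 := by
          rw [div_pow, sq, sq]; field_simp
        calc (B.card : ℝ) * ((𝔥 / R) ^ 2 * ((B.card : ℝ)⁻¹ * (2 * t * (R / 𝔥) * (R / 𝔥))))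
            = ((B.card : ℝ) * (B.card : ℝ)⁻¹) * (2 * t) * ((𝔥 / R) ^ 2 * ((R / 𝔥) * (R / 𝔥))) := by ring
          _ = 2 * t := by rw [mul_inv_cancel₀ hB'.ne', h1, one_mul, mul_one]

omit [NeZero M] in
/-- Bookkeeping for the linear coefficients: the weights cancel.
[cite: AdamsBuchholzKoteckyMuller2019, proof of Lemma 8.7 (8.53)] -/
theorem lin_weights_cancel {n Sg Ca Ra 𝔥 t m : ℝ} (hn : n ≠ 0) (h𝔥 : 𝔥 ≠ 0) (hRa : Ra ≠ 0) :
    n * (𝔥 * Ra⁻¹ * (m * (n⁻¹ * Sg * Ca * Ra * 𝔥⁻¹ * t))) = m * Sg * Ca * t := by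
  field_simp

/-- A linear coefficient: `|B| 𝔥 R^{-|α|} |a_α| ≤ |v_1| S C₀^{⌊d/2⌋+1} |K|_{T_0}`.
[cite: AdamsBuchholzKoteckyMuller2019, proof of Lemma 8.7 (8.53)] -/
theorem card_mul_norm_Pi2_lin_le (hB : B.card ≠ 0) (hBS : B ⊆ S) (hS : ∀ x ∈ S, HasRoom c x p)
    (hSρ : ∀ x ∈ S, ∀ i, |relCoord c x i| ≤ ρ) (h𝔥 : 0 < 𝔥) (hR : 0 < R) (hC₀ : 1 ≤ C₀)
    (hρ : (ρ : ℝ) + (d / 2 + 1 : ℕ) ≤ C₀ * R) (hr₀ : 2 ≤ r₀) (hK : ContDiff ℝ r₀ K)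
    (hloc : IsGaugeLocal (fieldGauge 𝔥 R p S) K) (α : linIndex d) :
    (B.card : ℝ) * (𝔥 * (R ^ (∑ i, (α : Fin d → ℕ) i))⁻¹ * ‖Pi2 c B K (Sum.inr (Sum.inl α))‖) ≤
      Fintype.card (linIndex d) * pi2GeoSum d * C₀ ^ (d / 2 + 1) *
        tayNorm (fieldGauge 𝔥 R p S) r₀ K 0 := by
  set T := fieldGauge 𝔥 R p S with hT
  set t := tayNorm T r₀ K 0 with ht
  have ht0 : 0 ≤ t := tayNorm_nonneg _ _ _ _
  have hB' : (0 : ℝ) < B.card := by exact_mod_cast Nat.pos_of_ne_zero hB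
  have hBρ : ∀ x ∈ B, ∀ i, |relCoord c x i| ≤ ρ := fun x hx => hSρ x (hBS hx)
  have hSg := pi2GeoSum_nonneg d
  have hbα : ∀ α' : linIndex d, ‖T (polyField c (α' : Fin d → ℕ))‖ ≤
      C₀ ^ (∑ i, (α' : Fin d → ℕ) i) * R ^ (∑ i, (α' : Fin d → ℕ) i) / 𝔥 := fun α' => by
    refine norm_fieldGauge_polyField_le hS hSρ h𝔥 hR hC₀ _ ?_
    have h1 : ((∑ i, (α' : Fin d → ℕ) i : ℕ) : ℝ) ≤ ((d / 2 + 1 : ℕ) : ℝ) := by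
      exact_mod_cast (mem_linIndex.1 α'.2).2
    push_cast at h1 hρ ⊢
    linarith
  unfold Pi2
  rw [Pi2Data_lin]
  set a := ∑ i, (α : Fin d → ℕ) i with ha
  have hadeg : a ≤ d / 2 + 1 := (mem_linIndex.1 α.2).2
  have hterm : ∀ α' : linIndex d,
      ‖linSysInv c B α α' • fderiv ℝ K 0 (polyField c (α' : Fin d → ℕ))‖ ≤
        (B.card : ℝ)⁻¹ * pi2GeoSum d * C₀ ^ a * R ^ a * 𝔥⁻¹ * t := by
    intro α'
    set a' := ∑ i, (α' : Fin d → ℕ) i with ha'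
    rw [norm_smul, Real.norm_eq_abs]
    have hI := abs_linSysInv_le hB hBρ hR hC₀ hρ α α'
    have hk : ‖fderiv ℝ K 0 (polyField c (α' : Fin d → ℕ))‖ ≤ t * (C₀ ^ a' * R ^ a' / 𝔥) :=
      (norm_fderiv_apply_le_tayNorm (by omega) hK hloc 0 _).trans
        (mul_le_mul_of_nonneg_left (hbα α') ht0)
    have hCR : (C₀ * R) ^ a' ≠ 0 := by positivity
    calc |linSysInv c B α α'| * ‖fderiv ℝ K 0 (polyField c (α' : Fin d → ℕ))‖
        ≤ ((B.card : ℝ)⁻¹ * pi2GeoSum d * (C₀ * R) ^ a / (C₀ * R) ^ a') * (t * (C₀ ^ a' * R ^ a' / 𝔥)) :=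
          mul_le_mul hI hk (norm_nonneg _) (by positivity)
      _ = (B.card : ℝ)⁻¹ * pi2GeoSum d * C₀ ^ a * R ^ a * 𝔥⁻¹ * t := by
          rw [mul_pow, mul_pow, div_eq_mul_inv _ 𝔥]
          field_simp
  calc (B.card : ℝ) * (𝔥 * (R ^ a)⁻¹ *
        ‖∑ α' : linIndex d, linSysInv c B α α' • fderiv ℝ K 0 (polyField c (α' : Fin d → ℕ))‖)
      ≤ (B.card : ℝ) * (𝔥 * (R ^ a)⁻¹ *
        ∑ α' : linIndex d, ‖linSysInv c B α α' • fderiv ℝ K 0 (polyField c (α' : Fin d → ℕ))‖) := by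
        gcongr; exact norm_sum_le _ _
    _ ≤ (B.card : ℝ) * (𝔥 * (R ^ a)⁻¹ *
        ∑ _α' : linIndex d, (B.card : ℝ)⁻¹ * pi2GeoSum d * C₀ ^ a * R ^ a * 𝔥⁻¹ * t) := by
        gcongr with α' _; exact hterm α'
    _ = Fintype.card (linIndex d) * pi2GeoSum d * C₀ ^ a * t := by
        rw [Finset.sum_const, Finset.card_univ, nsmul_eq_mul]
        exact lin_weights_cancel hB'.ne' h𝔥.ne' (by positivity)
    _ ≤ Fintype.card (linIndex d) * pi2GeoSum d * C₀ ^ (d / 2 + 1) * t := by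
        have hpow : C₀ ^ a ≤ C₀ ^ (d / 2 + 1) := pow_le_pow_right₀ hC₀ hadeg
        gcongr

end Parts

/-- **[ABKM19] Lemma 8.7 (boundedness of `Π₂`).** For a block `B ⊆ S` (`|B| ≠ 0`) inside the box
`|z|_∞ ≤ ρ` around the centre `c`, with room for `p` lattice steps on `S` and `ρ + ⌊d/2⌋+1 ≤ C₀R`
(`C₀ ≥ 1`), and a `C^{r₀}` functional `K` (`r₀ ≥ 2`) that is local for the gauge
`T = fieldGauge 𝔥 R p S`:  `‖Π₂K‖_{k,0} ≤ C(d, C₀) · |K|_{T_0}`.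
[cite: AdamsBuchholzKoteckyMuller2019, Lemma 8.7] -/
theorem hamNorm_Pi2_le {c : Fin d → ZMod M} {B S : Finset (Fin d → ZMod M)} (hB : B.card ≠ 0)
    (hBS : B ⊆ S) {p ρ : ℕ} (hS : ∀ x ∈ S, HasRoom c x p)
    (hSρ : ∀ x ∈ S, ∀ i, |relCoord c x i| ≤ ρ) {𝔥 R C₀ : ℝ} (h𝔥 : 0 < 𝔥) (hR : 0 < R)
    (hC₀ : 1 ≤ C₀) (hρ : (ρ : ℝ) + (d / 2 + 1 : ℕ) ≤ C₀ * R) {r₀ : ℕ} (hr₀ : 2 ≤ r₀)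
    {K : ((Fin d → ZMod M) → ℝ) → 𝕜} (hK : ContDiff ℝ r₀ K)
    (hloc : IsGaugeLocal (fieldGauge 𝔥 R p S) K) :
    hamNorm 𝔥 R B.card (Pi2 c B K) ≤
      pi2BoundConst d C₀ * tayNorm (fieldGauge 𝔥 R p S) r₀ K 0 := by
  set t := tayNorm (fieldGauge 𝔥 R p S) r₀ K 0 with ht
  have h0 := card_mul_norm_Pi2_const_le (c := c) (r₀ := r₀) hB hloc
  have h2 := fun q => card_mul_norm_Pi2_quad_le (c := c) hB hS h𝔥 hR hr₀ hK hloc q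
  have h1 := fun α => card_mul_norm_Pi2_lin_le (c := c) hB hBS hS hSρ h𝔥 hR hC₀ hρ hr₀ hK hloc α
  unfold hamNorm pi2BoundConst
  rw [mul_add, mul_add, Finset.mul_sum, Finset.mul_sum]
  have hq : ∑ q : quadIndex d, (B.card : ℝ) * ((𝔥 / R) ^ 2 * ‖Pi2 c B K (Sum.inr (Sum.inr q))‖) ≤
      2 * Fintype.card (quadIndex d) * t := by
    refine (Finset.sum_le_sum fun q _ => h2 q).trans (le_of_eq ?_)
    rw [Finset.sum_const, Finset.card_univ, nsmul_eq_mul]; ring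
  have hl : ∑ α : linIndex d, (B.card : ℝ) * (𝔥 * (R ^ (∑ i, (α : Fin d → ℕ) i))⁻¹ *
      ‖Pi2 c B K (Sum.inr (Sum.inl α))‖) ≤
      (Fintype.card (linIndex d) : ℝ) ^ 2 * pi2GeoSum d * C₀ ^ (d / 2 + 1) * t := by
    refine (Finset.sum_le_sum fun α _ => h1 α).trans (le_of_eq ?_)
    rw [Finset.sum_const, Finset.card_univ, nsmul_eq_mul]; ring
  calc (B.card : ℝ) * ‖Pi2 c B K (Sum.inl ())‖ +
        ∑ α : linIndex d, (B.card : ℝ) * (𝔥 * (R ^ (∑ i, (α : Fin d → ℕ) i))⁻¹ *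
          ‖Pi2 c B K (Sum.inr (Sum.inl α))‖) +
        ∑ q : quadIndex d, (B.card : ℝ) * ((𝔥 / R) ^ 2 * ‖Pi2 c B K (Sum.inr (Sum.inr q))‖)
      ≤ t + (Fintype.card (linIndex d) : ℝ) ^ 2 * pi2GeoSum d * C₀ ^ (d / 2 + 1) * t +
        2 * Fintype.card (quadIndex d) * t := add_le_add (add_le_add h0 hl) hq
    _ = (1 + 2 * Fintype.card (quadIndex d) +
        (Fintype.card (linIndex d) : ℝ) ^ 2 * pi2GeoSum d * C₀ ^ (d / 2 + 1)) * t := by ring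

end Literature.MathematicalPhysics.StatisticalMechanics.GradientRG

end
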